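import Summits.MatrixMultiplication.OmegaCensus.STPPVosperSlackTwoLawT
import Summits.MatrixMultiplication.OmegaCensus.STPPVosperSlackTwoRows59L3AAsm
import Summits.MatrixMultiplication.OmegaCensus.STPPVosperSlackTwoRows59L3BAsm
import Summits.MatrixMultiplication.OmegaCensus.STPPVosperSlackTwoRows59L3CAsm
import Summits.MatrixMultiplication.OmegaCensus.STPPVosperSlackTwoRows59L3TblAAsm
import Summits.MatrixMultiplication.OmegaCensus.STPPVosperSlackTwoRows59L3TblBAsm
import Summits.MatrixMultiplication.OmegaCensus.STPPVosperSlackTwoRows59L3TblCAsm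
import Summits.MatrixMultiplication.OmegaCensus.STPPVosperTilingWordsPrunedQ
import Summits.MatrixMultiplication.OmegaCensus.STPPVosperTilingWordsPruned
import Summits.MatrixMultiplication.OmegaCensus.STPPHamidouneRodsethInverseTheorem

/-!
# ω-census (abelian STPP census): `{(2,3,3),(2,3,4),(3,2,3)} ⊄ ℤ₅₉` by the slack-2 partition law, table form (kernel, unconditional)

HONEST FRAMING (pub-omega census; verbatim): lottery ticket; floor = certified bounds/negative ranges.
Census EXCLUSION (seat pub-omega-stpp-1 gen 33 with the rows of seat pub-omega-stpp-2 gen 27, 2026-08-28), family (b2).  The three-block leaf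
`{(2,3,3),(2,3,4),(3,2,3)}` of the ℤ₅₉ STPP census (slack 2 at the `(2,3,4)` block: `z + b + vol + a + L = 15 + 3 + 24 + 2 + 15 = 59`) has NO
realisation: `no_isSTPP_of_slack_two_tables` (`STPPVosperSlackTwoLawT.lean`) at block `1` read `(a, b, c) = (2, 3, 4)` (`a = 2`: the pair `Aᵢ` is its
own 3-term-progression-minus-a-term), other blocks `[2, 0]` of sizes `(3,2,3)`, `(2,3,3)`, with the kernel rows `rows59L3A_choose` (case A, 290 dihedral
representatives of the three-shapes, table `tblZ59L3A`), `rows59L3B_choose` (case B′, 29 representatives of the two-shapes, `tblZ59L3B`), `rows59L3C_lit`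
(case C, PRUNED checker `caseCDeadTP`, `qShapesC 3 × pShapesC 59 2 × 15` holes, `tblZ59L3C`) and the words-cover table rows `dead59L3A` (direct,
`blockDiffsWP`), `dead59L3B` (direct, `blockDiffsWQ`), `dead59L3C` (role-swapped, `blockDiffsWQ`) (`STPPVosperSlackTwoRows59L3*.lean`, seat stpp-2 gen 27;
tables `STPPVosperSlackTwoTablesZ59.lean`).  Hamidoune–Rødseth is the tree theorem `hamidouneRodsethInverseTheorem_holds`.  Census consequence (lead's
words only): one of the three open ℤ₅₉ leaves.  Nothing here is progress on `ω`.

References: H. Cohn, R. Kleinberg, B. Szegedy, C. Umans, FOCS 2005 (arXiv:math/0511460), Def. 5.1; A. G. Vosper, J. London Math. Soc. 31 (1956);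
Y. O. Hamidoune, Ø. J. Rødseth, Acta Arith. 92 (2000).
-/

open Finset
open scoped Pointwise

namespace Summit.MatrixMultiplication.OmegaCensus.CubeNB

open Literature.Computability.AlgebraicComplexity
open Literature.Combinatorics.Additive
open Summit.MatrixMultiplication.OmegaCensus.STPPKneser
open Summit.MatrixMultiplication.OmegaCensus.CubeNB.S2

/-- **`{(2,3,3),(2,3,4),(3,2,3)} ⊄ ℤ₅₉` (kernel, unconditional).**  No simultaneous-triple-product family of `ℤ/59` has size pattern
`(|A₀|,|B₀|,|C₀|) = (2,3,3)`, `(|A₁|,|B₁|,|C₁|) = (2,3,4)`, `(|A₂|,|B₂|,|C₂|) = (3,2,3)`. [cite: CohnKleinbergSzegedyUmans2005, Def. 5.1]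
[cite: Vosper1956, main theorem; Nathanson1996, Thm 2.7] [cite: HamidouneRodseth2000, main theorem (§1, p. 252)] -/
theorem no_isSTPP_zmod59_233_234_323 (A B C : Fin 3 → Finset (ZMod 59)) (hS : IsSTPP A B C)
    (hA : ∀ i, #(A i) = ![2, 2, 3] i) (hB : ∀ i, #(B i) = ![3, 3, 2] i) (hC : ∀ i, #(C i) = ![3, 4, 3] i) : False := by
  haveI : Fact (Nat.Prime 59) := ⟨by norm_num⟩
  have hAne : ∀ i, (A i).Nonempty := fun i => card_pos.1 (by rw [hA]; fin_cases i <;> simp)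
  have hBne : ∀ i, (B i).Nonempty := fun i => card_pos.1 (by rw [hB]; fin_cases i <;> simp)
  have hCne : ∀ i, (C i).Nonempty := fun i => card_pos.1 (by rw [hC]; fin_cases i <;> simp)
  have e1 : (univ : Finset (Fin 3)).erase 1 = {0, 2} := by decide
  have hz : ∑ k ∈ (univ : Finset (Fin 3)).erase 1, #(A k) * #(C k) = 15 := by
    rw [e1, Finset.sum_pair (by decide)]; simp [hA, hC]
  have hL : ∑ k ∈ (univ : Finset (Fin 3)).erase 1, #(B k) * #(C k) = 15 := by
    rw [e1, Finset.sum_pair (by decide)]; simp [hB, hC]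
  have hszsA : ([2, 0] : List (Fin 3)).map (fun k => (#(A k), #(B k), #(C k))) = [(3, 2, 3), (2, 3, 3)] := by simp [hA, hB, hC]
  have hszsB : ([2, 0] : List (Fin 3)).map (fun k => (#(B k), #(A k), #(C k))) = [(2, 3, 3), (3, 2, 3)] := by simp [hA, hB, hC]
  have hdeadA : ∀ e ∈ tblZ59L3A, CoverDead 59 3 1 [(3, 2, 3), (2, 3, 3)] e.1 e.2 :=
    coverDead_forall_of_rows (blockEnumSound_blockDiffsWP 59) fun e he => dead59L3A e he
  have hdeadB : ∀ e ∈ tblZ59L3B, CoverDead 59 3 1 [(2, 3, 3), (3, 2, 3)] e.1 e.2 :=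
    coverDead_forall_of_rows (blockEnumSound_blockDiffsWQ 59) fun e he => dead59L3B e he
  have hdeadC : ∀ e ∈ tblZ59L3C, CoverDead 59 3 1 [(3, 2, 3), (2, 3, 3)] e.1 e.2 :=
    coverDead_forall_of_rows_swapped (blockEnumSound_blockDiffsWQ 59) fun e he => dead59L3C e he
  exact no_isSTPP_of_slack_two_tables hamidouneRodsethInverseTheorem_holds hS hAne hBne hCne 1 ⟨0, by decide⟩
    (a := 2) (b := 3) (c := 4) (L := 15) (z := 15) (vol := 24) (tblA := tblZ59L3A) (tblB := tblZ59L3B) (tblC := tblZ59L3C)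
    (by rw [hA]; rfl) (by rw [hB]; rfl) (by rw [hC]; rfl) hz hL rfl (by norm_num)
    (Or.inl rfl) (by norm_num) (by norm_num) (by norm_num) (by norm_num)
    [2, 0] (by decide) (fun k => by fin_cases k <;> decide) hszsA hszsB hdeadA hdeadB hdeadC
    rows59L3A_choose rows59L3B_choose (fun Q hQ P hP h hh => Or.inr (rows59L3C_lit Q hQ P hP h hh))

end Summit.MatrixMultiplication.OmegaCensus.CubeNB
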